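import Literature.NumberTheory.EllipticCurves.PastenValuationProductThm75Proofs
import Literature.NumberTheory.EllipticCurves.PeterssonNormLowerBoundProofs
import Literature.NumberTheory.EllipticCurves.PeterssonNormLowerBoundSqrtProofs
import Literature.NumberTheory.EllipticCurves.ModularCurveManinConstantProofs
import Literature.NumberTheory.EllipticCurves.Szpiro
import Literature.NumberTheory.DiophantineGeometry.FaltingsHeightProofs
import Literature.Barriers.ABC.SzpiroEpsilonCannotBeDroppedHolds
import HarnessLib
import HarnessLib.Audit

/-!
# ABC — analytic / modular lens: the typed REQUIREMENTS TABLE for polynomial Szpiro over `ℚ` (I)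

Cell `abc-an` (C1), seat `typ-1`; plan `run/shared/lean/pub/abc-an/plan/{SPEC,TABLE}.md`. File I (here): GAP rows R1 (modular degree), R5 (Faltings height),
their sharp forms, the A-PS skeletons S1/S2, exponents, floors. File II (`RequirementsCongruence`): congruence-number rows R4/R9, converse inputs (Manin,
Petersson upper), A0 skeletons. HONESTY: abc is not proved by any of this. The target, **A-PS** = polynomial Szpiro over `ℚ`
(`∃ K C, ∀ E/ℚ, log|Δ_min(E)| ≤ K · log N(E) + C`; LADDER-ABC §1 rung A-PS, HUMAN D-0139/D-0140) is **NOT abc — «NOT abc — POLY-SZPIRO(E)»**; full abc /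
Szpiro `6+ε` (rung A0) is the main goal (D-0140). Typed ≠ proved: every `@[conjecture] def` below is an OPEN statement, used only as a hypothesis.

## The chain and WHERE polynomiality is lost, term by term (Pasten 2024 §3 p. 13; tree decls by name)
MASTER IDENTITY (Frey 1989 via Zagier 1985; PROVED `ModularParametrizationData.two_mul_faltingsHeight_eq`): `2 h_F(E) = log deg φ − log(4π² c² (f,f))` on a
global minimal model (`c` Manin constant, `f` newform). DISCRIMINANT STEP (Silverman 1986; Pasten 2024 (3.1) / Lemma 18.1; PROVED
`WeierstrassCurve.log_minimalDiscriminantNorm_lt_faltingsHeight_holds`): `log|Δ_min| < 12 h_F + 16`. So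
`log|Δ_min(E)| < 6 log deg φ − 6 log(f,f) − 12 log|c| − 6 log(4π²) + 16`, and term by term:
* R2 Petersson `(f,f)` — polynomial, KNOWN: `e^{-4π/N}/(4π) ≤ (f,f)` PROVED (`IsNewformOf.exp_div_le_peterssonProduct`) is all A-PS needs (S1);
  `(f,f) ≫ N^{1−η}`, `η > ½`, PROVED (`HoffsteinLockhart1994_peterssonProduct_lower_bound_of_half_lt`, Iwaniec) sharpens the exponent (S1♯);
  `(f,f) ≫_ε N^{1−ε}` (Hoffstein–Lockhart 1994, NAMED FACT `murty_petersson_newform_lower_bound`) only for A0.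
* R3 `L(Sym² f, 2)` = `(f,f)` up to `N^{1+o(1)}` (Rankin–Selberg): not needed separately. R6 Manin constant: forward direction needs only `c ∈ ℤ∖{0}` (PROVED
  `maninConstant_ne_zero_holds`); a bound on `c` enters only the converse height ⇒ degree (file II). R7 isogeny: absolute constant `≤ 163` (Mazur–Kenku),
  enters only R4 ⇒ R1 (file II) — the rows quantify over every `E`, so no isogeny step is needed here.
* **R1 modular degree** — NOT KNOWN polynomially: best `log m_f ≤ (1/5) N log N` (Murty–Pasten 2013 Thm 4.3, tree `MurtyPasten.log_modularDegree_le`; Pasten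
  2024 Thm 7.2). GAP row `PolyModularDegreeRat K`.
* **R5 Faltings height** (the archimedean term `−½ log covol Λ`) — NOT KNOWN: best `h_F < 0.1 N log N + 11` (MP 2013 Thm 7.1, `MurtyPasten.faltingsHeight_lt`;
  Pasten 2024 Thm 7.5). GAP row `PolyFaltingsHeightRat K`.
* R11 (A1 comparison): Stewart–Yu `log|Δ| ≪ N^{1/3}(log N)³` (PROVED `stewart_yu_holds`, via abc triples) beats every modular `N log N` bound in the exponent;
  none is polynomial in `log N`.

## Skeletons in this file (sorry-free; NO named fact unless it appears in the signature)
* S1 `polySzpiroRat_of_polyModularDegree : PolyModularDegreeRat K → ∃ K' C', ∀ E, log|Δ_min| ≤ K' log N + C'`, `K' =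
  6K` (eff: `polySzpiroRatEff_of_polyModularDegreeRatEff`, constant `6 log C + 24π + 16`); S1♯ `…_sharp`: `K' = 6K − 3 +
  ε`, still hypothesis-free (PROVED Petersson `N^{1−η}`, `η > ½`); S1♭ `…_of_petersson`: `K' = 6(K−1) + ε` modulo `murty_petersson_newform_lower_bound`.
* S2 `polySzpiroRat_of_polyFaltingsHeight : PolyFaltingsHeightRat K → A-PS(12K)` (eff constant `12C +
  16`); `polyFaltingsHeightRat_of_polyModularDegreeRat` (R1 ⇒ R5, `K ↦
  K/2`); `heightConjectureRat_of_degreeConjectureRat` (R1♯ + HL ⇒ R5♯); `szpiro_of_heightConjectureRat` (R5♯ ⇒ `SzpiroConjecture`, hypothesis-free).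
* FLOORS (Masser 1990, PROVED barrier `SzpiroEpsilonCannotBeDropped_holds`): any A-PS exponent is `> 6`; `¬ PolyFaltingsHeightRat K` (`K ≤ ½`);
  `¬ PolyModularDegreeRat K` for `K < 3/2` unconditionally and for `K < 2` modulo HL — the rows are non-vacuous and their free exponents start at Frey's `2`
  resp. `½`.
The A-PS conclusion is stated UNFOLDED (literally LADDER-ABC §1 l.191) until the A1 cell lands `Summit.ABC.PolySzpiroRat`; a by-name re-export follows then
(log ↔ `rpow` bridge in file II). KERNEL STATEMENT OF THE CELL: **A-PS ⇐ `PolyModularDegreeRat K` alone (output exponent `6K − 3 + ε`)**, equivalently **⇐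
`PolyFaltingsHeightRat K` (`12K`)**: every other term of the chain is a theorem of the tree; polynomiality is lost at exactly ONE place, `deg φ_E` ⇔ `h_F(E)`
(⇔ `r_f`, file II), where print has `≍ N log N`, exponentially off `K log N`. The SHARP rows (`2+ε` / `½+ε`) are abc-EQUIVALENT on Frey curves (Murty 1999 Thm
1; tree `abcLe_iff_freyDegreeConjecture`) — restatements of abc strength, not a cheaper door; PATH to `1+ε`: none in print. EFFECTIVE: all glue constants
explicit.

References: [Frey1989]; [MaiMurty1994]; [MurtyCongruencePrimes1999] Thm 1; [MurtyPasten2013] p. 3748, Thms 4.3, 7.1; [PastenShimura2024] §3 p. 13, Lemma 18.1;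
[ZagierCMB1985]; [Masser1990]; [Iwaniec2002] 8.3; [SilvermanAEC2009].
-/

noncomputable section
namespace Summit.ABC.Analytic
open Literature.NumberTheory.EllipticCurves Literature.NumberTheory.EllipticCurves.ModularForms
open CongruenceSubgroup WeierstrassCurve

/-! ## §1 GAP rows R1, R5 (open statements; proof-free, used only as hypotheses) -/

/-- **R1 (GAP), effective form `(K, C)`: polynomial modular degree over `ℚ`.** Every elliptic `E/ℚ`, presented by a globally minimal model `W` with conductor
`N = W.conductorNorm ℤ`, admits a modular parametrisation datum at level `N` (`ModularParametrizationData`: newform, Néron lattice, integral Manin constant,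
degree) with `deg ≤ C · N ^ K`. This is Pasten 2024 Conj. 3.2 ("Modular degree conjecture; cf. Frey [FreyLinks]": `log δ_{1,N}(E) ≪ log N_E`; Murty–Pasten
2013 p. 3748: "`log m_f ≪ log N` is due to Frey") with the exponent explicit, in the tree's `∃ D` idiom (route item `SemistableDegreeConjecture` minus
`IsSemistable`, free exponent), which bundles modularity (fact `nonempty_modularParametrizationData`) and replaces the optimal `δ_{1,N}` by the minimal degree
over `E`'s own minimal model (`≤ 163 · δ_{1,N}`, Mazur–Kenku, Pasten p. 13). OPEN for every `K` (FALSE for `K < 3/2`, §4); best printed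
`log m_f ≤ (1/5) N log N` (MP 2013 Thm 4.3, tree `MurtyPasten.log_modularDegree_le`; Pasten 2024 Thm 7.2). STRENGTH: ⇒ POLY-SZPIRO(E = 6K − 3 + ε), PROVED
(S1♯). «NOT abc — POLY-SZPIRO(E)» (D-0139/D-0140); PATH to `1+ε`: none in print. CALIBRATION (REDUCTION CENSUS §R R2, 2026-08-27; computed ≠ proved — a FLOOR
on the admissible explicit `(K, C)`, never evidence for the statement): over ALL 3,064,705 curves `N < 500000` of Cremona's `ecdata` (`alldegphi` = minimal
parametrisation degree of every curve; ENG-MODDEG kit job j285537 = DESK-CALIB-1 j285151 = abc-an CALIB-1; PARI `ellmoddegree` 29/29)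
`μ = log deg φ / log N ≤ 2.17755`, attained at 279366b1 (`deg φ = 723333273600`); `105` curves (`54` optimal) have `deg φ > N²`, none `μ > 2.2`; so
`C = 1 ⇒ K ≥ 2.1776` and `C = e⁵ ⇒ K ≥ 1.7788`, with the band maximum still rising `+0.037 ± 0.007` per doubling (`N ≥ 4096`); `μ ≈ 0.671 + σ/6` (r = 0.936):
this envelope is the Szpiro-record tail of `Summit.ABC.PolySzpiroRatEff` (j285518), no independent signal. Explicit pairs below these floors are dead on
arrival; `K < 3/2` is refuted for every `C` (§4). [cite: PastenShimura2024, Conj. 3.2 (§3 p. 13)] [cite: MurtyPasten2013, §4 p. 3748] [cite: Frey1989] -/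
@[conjecture] def PolyModularDegreeRatEff (K C : ℝ) : Prop :=
  ∀ (W : WeierstrassCurve ℚ) [W.IsElliptic] [W.IsGloballyMinimal] [NeZero (W.conductorNorm ℤ)],
    ∃ D : ModularParametrizationData W (W.conductorNorm ℤ),
      (D.modularDegree : ℝ) ≤ C * (W.conductorNorm ℤ : ℝ) ^ K

/-- **R1 (GAP): polynomial modular degree over `ℚ` with exponent `K`** — `∃ C, PolyModularDegreeRatEff K C`; `∃ K, PolyModularDegreeRat K` is Pasten 2024 Conj.
3.2 / Frey's `log deg φ_E ≪ log N_E`. OPEN for every `K`. «NOT abc — POLY-SZPIRO(E = 6K − 3 + ε)» (D-0139/D-0140). CALIBRATION (computed ≠ proved; ENG-MODDEG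
j285537; table under `PolyModularDegreeRatEff`): in range a witness needs `K ≥ 2.1776` at `C = 1` (279366b1) — a floor on witnesses, silent on truth.
[cite: PastenShimura2024, Conj. 3.2] [cite: Frey1989] -/
@[conjecture] def PolyModularDegreeRat (K : ℝ) : Prop :=
  ∃ C : ℝ, PolyModularDegreeRatEff K C

/-- **R1♯ (A0-strength row): the SHARP modular degree conjecture for all `E/ℚ`** — for every `ε > 0`, `deg φ_E ≤ C(ε) · N_E ^ (2 + ε)` (here
`∀ ε > 0, PolyModularDegreeRat (2 + ε)`): "the degree conjecture (Frey) `deg φ_E = O(N^{2+ε})`" of Murty 1999 Thm 1 / Mai–Murty 1994. On the Frey–Hellegouarch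
curves it is EQUIVALENT to abc (Murty 1999 Thm 1; tree fact `abcLe_iff_freyDegreeConjecture`; Pasten 2024 Rem. 3.3) — a RESTATEMENT of abc strength, labelled
so; it restricts to the route item `SemistableDegreeConjecture` and, with the Petersson `1−ε` fact, gives `ABC` and Szpiro `6+ε` (file II:
`abc_of_degreeConjectureRat`). CALIBRATION (computed ≠ proved; ENG-MODDEG j285537, `N < 500000`): `C(ε) ≥ max deg φ / N^{2+ε}` forces `C(0) ≥ 9.268`,
`C(0.1) ≥ 2.645`, `C(0.2) ≥ 0.7547` (279366b1), still rising in range — the constant is load-bearing (`deg φ ≤ N²` fails `105` times). Frey–Hellegouarch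
family (40,438 curves): max `μ = 2.01033` at 53130bo2 = de Weger's `11² + 3²·5⁶·7³ = 2²¹·23` (quality `1.626`): the in-range calibration of this A0 row is the
abc-quality table in disguise — consistent with RESTATEMENT. [cite: MurtyCongruencePrimes1999, Thm. 1] [cite: MaiMurty1994]
[cite: PastenShimura2024, Rem. 3.3] -/
@[conjecture] def DegreeConjectureRat : Prop :=
  ∀ ε : ℝ, 0 < ε → PolyModularDegreeRat (2 + ε)

/-- **R5 (GAP), effective form `(K, C)`: polynomial Faltings height over `ℚ`** — `h_F(E) ≤ K log N_E + C` for every elliptic `E/ℚ`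
(`WeierstrassCurve.faltingsHeight`: Faltings' normalisation = Silverman's `h(E/ℚ)` = Pasten's `h(E)`; model-independent, `faltingsHeight_smul`). This is
Pasten 2024 Conj. 3.1 ("Height conjecture, cf. Frey: there is `κ` with `h(E) < κ log N_E`") with the exponent explicit (`N_E ≥ 11` absorbs `C`). THE
archimedean term of the chain: `2 h_F = −log covol(Λ_Néron)` (`faltingsHeight_eq_neg_half_log_covolume`). OPEN for every `K` (FALSE for `K ≤ ½`, §4); best
printed `h_F < 0.1 N log N + 11` (MP 2013 Thm 7.1, tree `MurtyPasten.faltingsHeight_lt`), `(1/48+ε) N log N` (Pasten 2024 Thm 7.5). STRENGTH: ⇒ POLY-SZPIRO(E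
= 12K) (S2, PROVED); ⇐ R1 with `K/2`. «NOT abc — POLY-SZPIRO(E)» (D-0139/D-0140). CALIBRATION (computed ≠ proved — a FLOOR on the admissible explicit
`(K, C)`, never evidence): `h_F` of ALL 3,064,705 curves `N < 500000` of Cremona's `ecdata` in THIS normalisation (`−½ log covol` of the minimal period
lattice; ENG-HEIGHT kit job j285597, Sage cross-check j285791): max `h_F / log N = 0.631292` at 279366b1 (`h_F = 7.916582`); so `C = 0 ⇒ K ≥ 0.6313`, and
`c_min(K) := max_E (h_F − K·log N)` gives `K = ½ ⇒ C ≥ 1.6464`, `K = 0.6 ⇒ C ≥ 0.3924`, `K = 2/3 ⇒ C ≥ −0.4389`, `K = 0.75 ⇒ C ≥ −1.3017` (11a2); for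
`K ≤ 0.65` the floor still rises at the edge of the range (`c_min(½)`: 0.23 at `N ≈ 10³` → 1.65, `+0.15` per doubling); in-range envelope slope
`≈ 0.75–0.79 = (max σ)/12` (archimedean term near its minimum `−1.3211`). OUT OF RANGE (E-B kit job j288511; beds = good abc triples read as Frey curves):
`C = 0 ⇒ K ≥ 0.69502` at the Frey class of `19·1307 + 7·29²·31⁸ = 2⁸·3²²·5⁴` (`N = 4,688,222,070`); 266 bed curves beat `0.631292`. `K ≤ ½` is refuted for
EVERY `C` (§4, Masser) although `(0.4, 3.0)` is uncontradicted in range. [cite: PastenShimura2024, Conj. 3.1 (§3 p. 13)] [cite: Frey1989] -/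
@[conjecture] def PolyFaltingsHeightRatEff (K C : ℝ) : Prop :=
  ∀ (W : WeierstrassCurve ℚ) [W.IsElliptic],
    W.faltingsHeight ≤ K * Real.log (W.conductorNorm ℤ) + C

/-- **R5 (GAP): polynomial Faltings height with exponent `K`** — `∃ C, ∀ E/ℚ, h_F(E) ≤ K log N_E + C`; `∃ K, PolyFaltingsHeightRat K` is Pasten 2024 Conj. 3.1
(Frey's height conjecture). OPEN. «NOT abc — POLY-SZPIRO(E = 12K)» (D-0139/D-0140). CALIBRATION (computed ≠ proved; ENG-HEIGHT j285597; table under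
`PolyFaltingsHeightRatEff`): in range a witness needs `K ≥ 0.6313` at `C = 0`, `C ≥ 1.6464` at `K = ½` (279366b1), out of range `K ≥ 0.69502` at `C = 0` (E-B
j288511); `K ≤ ½` refuted (§4). [cite: PastenShimura2024, Conj. 3.1] [cite: Frey1989] -/
@[conjecture] def PolyFaltingsHeightRat (K : ℝ) : Prop :=
  ∃ C : ℝ, PolyFaltingsHeightRatEff K C

/-- **R5♯ (A0-strength row): the SHARP height conjecture over `ℚ`** — for every `ε > 0`, `h_F(E) ≤ (½ + ε) log N_E + C(ε)`. Exponent `½` is the abc-strength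
value: abc ⇔ generalized Szpiro `max(|Δ_min|,|c₄|³) ≪ N^{6+ε}` gives it (`12 h_F = log max(…) + O(1)`, Silverman 1986), and it gives Szpiro `6+ε` for all
`E/ℚ` (`szpiro_of_heightConjectureRat`, PROVED glue); it follows from R1♯ and the Petersson `1−ε` fact (`heightConjectureRat_of_degreeConjectureRat`;
Mai–Murty 1994, the direction needing no Manin bound). A RESTATEMENT of abc strength on Frey curves, labelled so. CALIBRATION (computed ≠ proved; ENG-HEIGHT
j285597): `C(ε)` as `ε → 0` must exceed `c_min(½) = 1.6464` (279366b1, `N < 500000`), a floor still rising ≈ `+0.15` per doubling; the in-range envelope slope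
is ≈ ¾, so the data are silent on `½ + ε` (verdict «DRIFT (in range)»). [cite: MaiMurty1994] [cite: Frey1989] [cite: PastenShimura2024, §3 (3.1)–(3.2)] -/
@[conjecture] def HeightConjectureRat : Prop :=
  ∀ ε : ℝ, 0 < ε → PolyFaltingsHeightRat (1 / 2 + ε)

/-! ## §2 The proved links of the chain -/

section Links
variable {V : WeierstrassCurve ℚ} {N : ℕ} [NeZero N]

/-- **Zagier + Manin + a Petersson lower bound ⇒ a height bound** (datum level). For a globally minimal
elliptic `V/ℚ` with a datum `D` at level `N` and any positive `p ≤ (f,f)` for its newform: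
`2 h_F(V) ≤ log deg D − log(4π² p)` (`2h = log deg − log(4π²c²(f,f))`, `c ∈ ℤ∖{0}` so `c² ≥ 1`).
[cite: ZagierCMB1985, §1] [cite: PastenShimura2024, §3 (EqFrey)] -/
theorem two_mul_faltingsHeight_le_of_petersson [V.IsElliptic] [V.IsGloballyMinimal]
    (D : ModularParametrizationData V N) {p : ℝ} (hp : 0 < p)
    (hP : p ≤ (peterssonProduct (Gamma0 N) 2 D.f D.f).re) :
    2 * V.faltingsHeight ≤ Real.log D.modularDegree - Real.log (4 * Real.pi ^ 2 * p) := by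
  rw [D.two_mul_faltingsHeight_eq]
  have hc : (1 : ℝ) ≤ (D.maninConstant : ℝ) ^ 2 := by
    have h0 : D.maninConstant ≠ 0 := D.maninConstant_ne_zero_holds
    have h1 : (1 : ℤ) ≤ D.maninConstant ^ 2 := by
      nlinarith [Int.one_le_abs h0, sq_abs D.maninConstant]
    exact_mod_cast h1
  have hπ : (0 : ℝ) < 4 * Real.pi ^ 2 := by positivity
  have hle : 4 * Real.pi ^ 2 * p ≤
      4 * Real.pi ^ 2 * (D.maninConstant : ℝ) ^ 2 * (peterssonProduct (Gamma0 N) 2 D.f D.f).re := by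
    calc 4 * Real.pi ^ 2 * p = 4 * Real.pi ^ 2 * 1 * p := by ring
      _ ≤ 4 * Real.pi ^ 2 * (D.maninConstant : ℝ) ^ 2 * (peterssonProduct (Gamma0 N) 2 D.f D.f).re :=
        mul_le_mul (mul_le_mul_of_nonneg_left hc hπ.le) hP hp.le (by positivity)
  have hpos : 0 < 4 * Real.pi ^ 2 * p := by positivity
  linarith [Real.log_le_log hpos hle]

/-- **Curve level: a degree row and a Petersson lower bound `c · N^{−η} ≤ (f,f)` give height and
discriminant bounds for EVERY elliptic `W/ℚ`** (transport to a global minimal model `Cv • W`, Néron /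
Silverman AEC VIII.8.3: `hasGlobalMinimalModel_rat_holds`; `N_E`, `Δ_min`, `h_F` are invariants):
`2 h_F ≤ (K + η) log N + log C − log(4π² c)` and `log|Δ_min| ≤ 6(K + η) log N + 6 log C − 6 log(4π² c) + 16`.
[cite: PastenShimura2024, §3 (3.1)–(3.2)] -/
theorem height_discriminant_le_of_petersson {K C c η : ℝ} (h : PolyModularDegreeRatEff K C)
    (hc : 0 < c) (hP : ∀ (N : ℕ) [NeZero N] (V : WeierstrassCurve ℚ) [V.IsElliptic]
      (D : ModularParametrizationData V N), c * (N : ℝ) ^ (-η) ≤ (peterssonProduct (Gamma0 N) 2 D.f D.f).re)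
    (W : WeierstrassCurve ℚ) [W.IsElliptic] :
    2 * W.faltingsHeight ≤ (K + η) * Real.log (W.conductorNorm ℤ) +
        (Real.log C - Real.log (4 * Real.pi ^ 2 * c)) ∧
      Real.log (W.minimalDiscriminantNorm ℤ) ≤ 6 * (K + η) * Real.log (W.conductorNorm ℤ) +
        (6 * Real.log C - 6 * Real.log (4 * Real.pi ^ 2 * c) + 16) := by
  obtain ⟨Cv, hV⟩ := hasGlobalMinimalModel_rat_holds W
  haveI : (Cv • W).IsGloballyMinimal := hV
  haveI : NeZero ((Cv • W).conductorNorm ℤ) := NeZero.of_pos (conductorNorm_pos_holds (Cv • W))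
  obtain ⟨D, hD⟩ := h (Cv • W)
  rw [← faltingsHeight_smul W Cv, ← conductorNorm_smul_rat W Cv, ← minimalDiscriminantNorm_smul_rat W Cv]
  have hNpos : (0 : ℝ) < ((Cv • W).conductorNorm ℤ : ℝ) := by
    exact_mod_cast conductorNorm_pos_holds (Cv • W)
  have hNη : (0 : ℝ) < ((Cv • W).conductorNorm ℤ : ℝ) ^ (-η) := Real.rpow_pos_of_pos hNpos _
  have hz := two_mul_faltingsHeight_le_of_petersson D (mul_pos hc hNη) (hP _ (Cv • W) D)
  have hdeg : (1 : ℝ) ≤ (D.modularDegree : ℝ) := by exact_mod_cast D.deg_pos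
  have hNK : (0 : ℝ) < ((Cv • W).conductorNorm ℤ : ℝ) ^ K := Real.rpow_pos_of_pos hNpos K
  have hCpos : 0 < C := by
    by_contra hC
    have : C * ((Cv • W).conductorNorm ℤ : ℝ) ^ K ≤ 0 :=
      mul_nonpos_of_nonpos_of_nonneg (not_lt.mp hC) hNK.le
    linarith
  have hlogdeg : Real.log D.modularDegree ≤ Real.log C + K * Real.log ((Cv • W).conductorNorm ℤ) := by
    have := Real.log_le_log (by linarith) hD
    rwa [Real.log_mul hCpos.ne' hNK.ne', Real.log_rpow hNpos] at this
  have hlogp : Real.log (4 * Real.pi ^ 2 * (c * ((Cv • W).conductorNorm ℤ : ℝ) ^ (-η))) =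
      Real.log (4 * Real.pi ^ 2 * c) + (-η) * Real.log ((Cv • W).conductorNorm ℤ) := by
    rw [← mul_assoc, Real.log_mul (by positivity) hNη.ne', Real.log_rpow hNpos]
  rw [hlogp] at hz
  have h2 := WeierstrassCurve.log_minimalDiscriminantNorm_lt_faltingsHeight_holds (Cv • W)
  rw [minimalDiscriminantNorm_ringOfIntegers_rat_holds, Module.finrank_self, Nat.cast_one, inv_one,
    one_mul] at h2
  constructor
  · linarith
  · linarith

/-- The trivial Petersson input in `N^{−η}` form, `η = 0`: `e^{−4π}/(4π) · N⁰ ≤ (f,f)` (from the PROVED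
`e^{−4π/N}/(4π) ≤ (f,f)`). [cite: PastenShimura2024, §3] -/
theorem trivial_petersson_input (N : ℕ) [NeZero N] (V : WeierstrassCurve ℚ) [V.IsElliptic]
    (D : ModularParametrizationData V N) :
    Real.exp (-(4 * Real.pi)) / (4 * Real.pi) * (N : ℝ) ^ (-(0 : ℝ)) ≤
      (peterssonProduct (Gamma0 N) 2 D.f D.f).re := by
  rw [neg_zero, Real.rpow_zero, mul_one]
  refine le_trans ?_ D.isNewformOf.exp_div_le_peterssonProduct
  have hN : (1 : ℝ) ≤ N := by exact_mod_cast Nat.one_le_iff_ne_zero.mpr (NeZero.ne N)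
  have : -(4 * Real.pi) ≤ -(4 * Real.pi / N) := by
    rw [neg_le_neg_iff, div_le_iff₀ (by positivity)]; nlinarith [Real.pi_pos]
  exact div_le_div_of_nonneg_right (Real.exp_le_exp.mpr this) (by positivity)

/-- `log x ≤ K log y + B` with `x, y > 0` gives `x ≤ e^B · y^K`. [folklore] -/
theorem le_exp_mul_rpow_of_log_le {x y K B : ℝ} (hx : 0 < x) (hy : 0 < y)
    (h : Real.log x ≤ K * Real.log y + B) : x ≤ Real.exp B * y ^ K := by
  calc x = Real.exp (Real.log x) := (Real.exp_log hx).symm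
    _ ≤ Real.exp (K * Real.log y + B) := Real.exp_le_exp.mpr h
    _ = Real.exp B * y ^ K := by
        rw [Real.exp_add, Real.rpow_def_of_pos hy, mul_comm (Real.log y) K, mul_comm]

end Links
/-! ## §3 S1: A-PS ⇐ R1 (three exponent grades) · S2: A-PS ⇐ R5 · R1 ⇒ R5 · R1♯ ⇒ R5♯ ⇒ Szpiro -/

/-- **S1, effective, hypothesis-free: `PolyModularDegreeRatEff K C` ⇒ `log|Δ_min(E)| ≤ 6K log N_E +
(6 log C + 24π + 16)` for every `E/ℚ`** (trivial Petersson bound; `−6 log(4π² · e^{−4π}/4π) = 24π − 6 log π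
≤ 24π`). NOT abc — «POLY-SZPIRO(E = 6K)» (D-0139/D-0140). [cite: PastenShimura2024, §3 (3.1)–(3.2)] -/
theorem polySzpiroRatEff_of_polyModularDegreeRatEff {K C : ℝ} (h : PolyModularDegreeRatEff K C)
    (W : WeierstrassCurve ℚ) [W.IsElliptic] :
    Real.log (W.minimalDiscriminantNorm ℤ) ≤
      6 * K * Real.log (W.conductorNorm ℤ) + (6 * Real.log C + 24 * Real.pi + 16) := by
  have h := (height_discriminant_le_of_petersson h (by positivity) trivial_petersson_input W).2
  rw [Pasten2024.log_four_pi_sq_mul_trivialPeterssonConst] at h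
  have hπ : 0 ≤ Real.log Real.pi := Real.log_nonneg (by linarith [Real.pi_gt_three])
  linarith

/-- **S1 (THE KERNEL STATEMENT OF THE CELL): polynomial modular degree ⇒ polynomial Szpiro over `ℚ`, NO
other hypothesis.** The conclusion is LITERALLY the A-PS sentence of LADDER-ABC §1 (`K' = 6K`; re-export
against `Summit.ABC.PolySzpiroRat` by name once that decl lands). NOT abc — «POLY-SZPIRO(E = 6K)».
[cite: PastenShimura2024, §3 (3.1)–(3.2)] [cite: MurtyCongruencePrimes1999, Thm. 1 (i), free exponent] -/
theorem polySzpiroRat_of_polyModularDegree {K : ℝ} (h : PolyModularDegreeRat K) :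
    ∃ K' C' : ℝ, ∀ (W : WeierstrassCurve ℚ) [W.IsElliptic],
      Real.log (W.minimalDiscriminantNorm ℤ) ≤ K' * Real.log (W.conductorNorm ℤ) + C' := by
  obtain ⟨C, hC⟩ := h
  exact ⟨6 * K, _, fun W _ => polySzpiroRatEff_of_polyModularDegreeRatEff hC W⟩

/-- **S1♯ (hypothesis-free, sharper exponent): `PolyModularDegreeRat K` ⇒ A-PS with exponent `6K − 3 + ε`**
for every `ε > 0`, using the PROVED Petersson bound `(f,f) ≫_η N^{1−η}` (`η > ½`; Iwaniec, tree theorem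
`HoffsteinLockhart1994_peterssonProduct_lower_bound_of_half_lt`) at `η = ½ + ε/6`. NOT abc —
«POLY-SZPIRO(E = 6K − 3 + ε)» (D-0139/D-0140). [cite: Iwaniec2002, Thm. 8.3] [cite: PastenShimura2024, §3] -/
theorem polySzpiroRat_of_polyModularDegreeRat_sharp {K ε : ℝ} (hε : 0 < ε) (h : PolyModularDegreeRat K) :
    ∃ C' : ℝ, ∀ (W : WeierstrassCurve ℚ) [W.IsElliptic],
      Real.log (W.minimalDiscriminantNorm ℤ) ≤ (6 * K - 3 + ε) * Real.log (W.conductorNorm ℤ) + C' := by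
  obtain ⟨C, hC⟩ := h
  obtain ⟨c, hc, hPc⟩ :=
    HoffsteinLockhart1994_peterssonProduct_lower_bound_of_half_lt (ε := 1 / 2 + ε / 6) (by linarith)
  refine ⟨6 * Real.log C - 6 * Real.log (4 * Real.pi ^ 2 * c) + 16, fun W _ => ?_⟩
  have h := (height_discriminant_le_of_petersson (η := -(1 - (1 / 2 + ε / 6))) hC hc
    (fun N _ V _ D => by rw [neg_neg]; exact hPc N V D) W).2
  have : 6 * (K + -(1 - (1 / 2 + ε / 6))) = 6 * K - 3 + ε := by ring
  rw [this] at h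
  exact h

/-- **S1♭ (sharpest exponent, modulo the Hoffstein–Lockhart NAMED FACT `(f,f) ≫_ε N^{1−ε}`):
`PolyModularDegreeRat K` ⇒ A-PS with exponent `6(K − 1) + ε`** (so Frey's `K = 2+ε` gives Szpiro `6+ε'`).
NOT abc — «POLY-SZPIRO(E = 6(K−1) + ε)». [cite: HoffsteinLockhart1994, Thm. 0.1] [cite: MurtyCongruencePrimes1999, §2] -/
theorem polySzpiroRat_of_polyModularDegreeRat_of_petersson (hP : murty_petersson_newform_lower_bound)
    {K ε : ℝ} (hε : 0 < ε) (h : PolyModularDegreeRat K) :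
    ∃ C' : ℝ, ∀ (W : WeierstrassCurve ℚ) [W.IsElliptic],
      Real.log (W.minimalDiscriminantNorm ℤ) ≤ (6 * (K - 1) + ε) * Real.log (W.conductorNorm ℤ) + C' := by
  obtain ⟨C, hC⟩ := h
  obtain ⟨c, hc, hPc⟩ := hP (ε / 6) (by positivity)
  refine ⟨6 * Real.log C - 6 * Real.log (4 * Real.pi ^ 2 * c) + 16, fun W _ => ?_⟩
  have h := (height_discriminant_le_of_petersson (η := -(1 - ε / 6)) hC hc
    (fun N _ V _ D => by rw [neg_neg]; exact hPc N V D.f D.isNewformOf) W).2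
  have : 6 * (K + -(1 - ε / 6)) = 6 * (K - 1) + ε := by ring
  rw [this] at h
  exact h

/-- **S2, effective: `PolyFaltingsHeightRatEff K C` ⇒ A-PS-eff with exponent `12K`, constant `12C + 16`**
(one line from `log|Δ_min| < 12 h_F + 16`, PROVED `log_minimalDiscriminantNorm_lt_faltingsHeight_holds`; its `ℤ`-form is
the tree's `DegreePrimesPolyBounded.log_minimalDiscriminantNorm_int_lt_faltingsHeight`, not imported here to stay out of
the route cone). NOT abc — «POLY-SZPIRO(E = 12K)». [cite: PastenShimura2024, Lemma 18.1] -/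
theorem polySzpiroRatEff_of_polyFaltingsHeightRatEff {K C : ℝ} (h : PolyFaltingsHeightRatEff K C)
    (W : WeierstrassCurve ℚ) [W.IsElliptic] :
    Real.log (W.minimalDiscriminantNorm ℤ) ≤ 12 * K * Real.log (W.conductorNorm ℤ) + (12 * C + 16) := by
  have h1 := h W
  have h2 := WeierstrassCurve.log_minimalDiscriminantNorm_lt_faltingsHeight_holds W
  rw [minimalDiscriminantNorm_ringOfIntegers_rat_holds W, Module.finrank_self, Nat.cast_one, inv_one,
    one_mul] at h2
  linarith

/-- **S2: polynomial Faltings height ⇒ polynomial Szpiro over `ℚ`** (exponent `12K`), no other hypothesis.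
NOT abc — «POLY-SZPIRO(E = 12K)» (D-0139/D-0140). [cite: PastenShimura2024, Lemma 18.1] -/
theorem polySzpiroRat_of_polyFaltingsHeight {K : ℝ} (h : PolyFaltingsHeightRat K) :
    ∃ K' C' : ℝ, ∀ (W : WeierstrassCurve ℚ) [W.IsElliptic],
      Real.log (W.minimalDiscriminantNorm ℤ) ≤ K' * Real.log (W.conductorNorm ℤ) + C' := by
  obtain ⟨C, hC⟩ := h
  exact ⟨12 * K, 12 * C + 16, fun W _ => polySzpiroRatEff_of_polyFaltingsHeightRatEff hC W⟩

/-- **R1 ⇒ R5** (`PolyModularDegreeRat K → PolyFaltingsHeightRat (K/2)`; Zagier + `c ≠ 0` + trivial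
Petersson, PROVED). The converse needs a Manin bound and a Petersson upper bound (file II).
[cite: PastenShimura2024, §3 (3.2)] -/
theorem polyFaltingsHeightRat_of_polyModularDegreeRat {K : ℝ} (h : PolyModularDegreeRat K) :
    PolyFaltingsHeightRat (K / 2) := by
  obtain ⟨C, hC⟩ := h
  refine ⟨(Real.log C - Real.log (4 * Real.pi ^ 2 * (Real.exp (-(4 * Real.pi)) / (4 * Real.pi)))) / 2,
    fun W _ => ?_⟩
  have h := (height_discriminant_le_of_petersson hC (by positivity) trivial_petersson_input W).1
  linarith

/-- **R1♯ + Petersson ⇒ R5♯**: the sharp degree conjecture and `(f,f) ≫_ε N^{1−ε}` (NAMED FACT) give the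
sharp height conjecture (`2h ≤ (2+ε) log N − (1−ε) log N + O_ε(1)`; Mai–Murty 1994, the direction needing
no Manin bound). [cite: MaiMurty1994] [cite: MurtyCongruencePrimes1999, §2] -/
theorem heightConjectureRat_of_degreeConjectureRat (hP : murty_petersson_newform_lower_bound)
    (h : DegreeConjectureRat) : HeightConjectureRat := by
  intro ε hε
  obtain ⟨C, hC⟩ := h ε hε
  obtain ⟨c, hc, hPc⟩ := hP ε hε
  refine ⟨(Real.log C - Real.log (4 * Real.pi ^ 2 * c)) / 2, fun W _ => ?_⟩
  have h := (height_discriminant_le_of_petersson (η := -(1 - ε)) hC hc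
    (fun N _ V _ D => by rw [neg_neg]; exact hPc N V D.f D.isNewformOf) W).1
  linarith

/-- **R5♯ ⇒ Szpiro `6+ε` for all `E/ℚ`, no other hypothesis** (`h_F ≤ (½ + ε/12) log N + C` and
`log|Δ_min| < 12 h_F + 16` give `|Δ_min| ≤ e^{12C+16} N^{6+ε}`; conclusion = `SzpiroConjecture`, Silverman
AEC VIII.11.1). [cite: PastenShimura2024, §3 (3.1)] [cite: SilvermanAEC2009, Conj. VIII.11.1] -/
theorem szpiro_of_heightConjectureRat (h : HeightConjectureRat) : SzpiroConjecture := by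
  intro ε hε
  obtain ⟨C, hC⟩ := h (ε / 12) (by positivity)
  refine ⟨Real.exp (12 * C + 16), fun W _ => ?_⟩
  have hN : (0 : ℝ) < (W.conductorNorm ℤ : ℝ) := by exact_mod_cast conductorNorm_pos_holds W
  have hΔ : (0 : ℝ) < (W.minimalDiscriminantNorm ℤ : ℝ) := by
    exact_mod_cast minimalDiscriminantNorm_pos_holds W
  have h1 := hC W
  have h2 := WeierstrassCurve.log_minimalDiscriminantNorm_lt_faltingsHeight_holds W
  rw [minimalDiscriminantNorm_ringOfIntegers_rat_holds W, Module.finrank_self, Nat.cast_one, inv_one,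
    one_mul] at h2
  refine le_exp_mul_rpow_of_log_le hΔ hN ?_
  have : 12 * ((1 / 2 + ε / 12) * Real.log (W.conductorNorm ℤ)) = (6 + ε) * Real.log (W.conductorNorm ℤ) := by
    ring
  linarith

/-! ## §4 Floors (consistency: the rows are non-vacuous; Masser's `ε` cannot be dropped) -/

/-- **No A-PS with exponent `≤ 6`**: `¬ ∀ E, log|Δ_min| ≤ K log N + C` whenever `K ≤ 6` (Masser 1990; PROVED
barrier `Literature.Barriers.ABC.SzpiroEpsilonCannotBeDropped_holds`). So every realisation of a GAP row
gives «POLY-SZPIRO(E)» with `E > 6` — NOT abc, and not even Szpiro `6+ε`. [cite: Masser1990, Theorem] -/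
theorem not_polySzpiroLog_of_le_six {K C : ℝ} (hK : K ≤ 6) :
    ¬ ∀ (W : WeierstrassCurve ℚ) [W.IsElliptic],
      Real.log (W.minimalDiscriminantNorm ℤ) ≤ K * Real.log (W.conductorNorm ℤ) + C := by
  intro h
  refine Literature.Barriers.ABC.SzpiroEpsilonCannotBeDropped_holds ⟨Real.exp C, 0, fun W _ => ?_⟩
  have hN : (0 : ℝ) < (W.conductorNorm ℤ : ℝ) := by exact_mod_cast conductorNorm_pos_holds W
  have hN1 : (1 : ℝ) ≤ (W.conductorNorm ℤ : ℝ) := by exact_mod_cast conductorNorm_pos_holds W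
  have hΔ : (0 : ℝ) < (W.minimalDiscriminantNorm ℤ : ℝ) := by
    exact_mod_cast minimalDiscriminantNorm_pos_holds W
  rw [Real.rpow_zero, mul_one]
  calc (W.minimalDiscriminantNorm ℤ : ℝ) ≤ Real.exp C * (W.conductorNorm ℤ : ℝ) ^ K :=
        le_exp_mul_rpow_of_log_le hΔ hN (h W)
    _ ≤ Real.exp C * (W.conductorNorm ℤ : ℝ) ^ (6 : ℝ) :=
        mul_le_mul_of_nonneg_left (Real.rpow_le_rpow_of_exponent_le hN1 hK) (Real.exp_pos _).le
    _ = Real.exp C * (W.conductorNorm ℤ : ℝ) ^ 6 := by norm_cast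

/-- **R5 floor: `PolyFaltingsHeightRat K` is FALSE for `K ≤ ½`** (S2 gives exponent `12K ≤ 6`; Masser).
So the free exponent of R5 starts exactly at the sharp row's `½`. [cite: Masser1990, Theorem] -/
theorem not_polyFaltingsHeightRat_of_le_half {K : ℝ} (hK : K ≤ 1 / 2) : ¬ PolyFaltingsHeightRat K := by
  rintro ⟨C, hC⟩
  exact not_polySzpiroLog_of_le_six (C := 12 * C + 16) (by linarith)
    fun W _ => polySzpiroRatEff_of_polyFaltingsHeightRatEff hC W

/-- **R1 floor (unconditional): `PolyModularDegreeRat K` is FALSE for `K < 3/2`** (S1♯ gives exponent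
`6K − 3 + ε ≤ 6` for small `ε`; Masser). Cf. the tree's semistable `not_degreeBound_of_lt_three_halves`.
[cite: Masser1990, Theorem] [cite: Iwaniec2002, Thm. 8.3] -/
theorem not_polyModularDegreeRat_of_lt_three_halves {K : ℝ} (hK : K < 3 / 2) :
    ¬ PolyModularDegreeRat K := by
  intro h
  obtain ⟨C', hC'⟩ := polySzpiroRat_of_polyModularDegreeRat_sharp (ε := 9 - 6 * K) (by linarith) h
  exact not_polySzpiroLog_of_le_six (by linarith) hC'

/-- **R1 floor modulo Hoffstein–Lockhart: `PolyModularDegreeRat K` is FALSE for `K < 2`** (S1♭ gives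
exponent `6(K−1) + ε ≤ 6`; Masser) — so, granted the Petersson `1−ε` fact, the free exponent of R1 starts
exactly at Frey's `2`. [cite: Masser1990, Theorem] [cite: HoffsteinLockhart1994, Thm. 0.1] -/
theorem not_polyModularDegreeRat_of_lt_two (hP : murty_petersson_newform_lower_bound) {K : ℝ}
    (hK : K < 2) : ¬ PolyModularDegreeRat K := by
  intro h
  obtain ⟨C', hC'⟩ := polySzpiroRat_of_polyModularDegreeRat_of_petersson hP (ε := 12 - 6 * K)
    (by linarith) h
  exact not_polySzpiroLog_of_le_six (by linarith) hC'

end Summit.ABC.Analytic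
end
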